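import Summits.ValiantsHypothesis.ValiantsHypothesis.Theorems.SuccinctLiftCharTwo
import Literature.LinearAlgebra.QuadraticForm.ArfInvariant

/-!
# `SuccinctLift` — the RESIDUE-TWO RUNG of the constant dial under WALL-D (`AlgDescentLog3`, stmt 23721)

Helper theorems for the route's one open crux `AlgDescentLog3` (⟺ lens 4's `PerHardLog3` by
`Theorems.SuccinctLiftCharTwo.algDescentLog3_iff_perHardLog3`): per has no `(n^c+c)`-wire circuits of
product-depth `Δ₁(n) = log₂ log₂ log₂ n + 1` over the ALGEBRAIC NUMBERS.  The crux is a statement about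
the CONSTANT RING.  This file decides, GRH-free and sorry-free, the whole region of the constant dial
that the characteristic-two method reaches, and certifies its exact boundary.

* §1 `not_perEasyMod_two_log3` — per is hard at `Δ₁` over the prime field `𝔽₂` itself (the char-2
  line of `Theorems.SuccinctLiftCharTwo` with the prime pinned to `2`: Boolean bridge + MAJORITY gadget +
  the tree's proved Razborov–Smolensky bound).
* §2 `exists_zmod_circuit_of_ringHom`, `perHard_of_ringHom` — SKELETON-EXACT TRANSFER: over ANY
  commutative ring `R` with a ring map `φ : R →+* 𝔽_p`, a circuit computing `u • per_n` with `φ u = 1`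
  maps (`ArithCircuit.map φ`) to an `𝔽_p`-circuit computing `per_n` with the same product-depth and the
  same number of wires; hence hardness over `𝔽_p` at ANY budget transfers to every such `R`, uniformly
  (one `n` per exponent `c`, for all `R`, `φ`, `u` at once).
* §3 THE RUNG at `Δ₁` (all unconditional): per — and every multiple `u • per_n` with `u ↦ 1` — is hard
  at `Δ₁` over: `ℤ` and all ODD integer multiples (`perHard_int_oddMultiple_log3`); `ℤ/mℤ` for every
  even `m`, in particular `ℤ/4`, `ℤ/2^k` (`perHard_zmod_even_log3`) — rings over which `per_n` is
  computable in polynomial TIME (Valiant 1979) yet has no shallow small circuits; the `2`-adic integers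
  `ℤ₂` (`perHard_padicInt_two_log3`) and `ℤ⟦X⟧` (`perHard_powerSeries_int_log3`) — UNCOUNTABLE constant
  rings; every quadratic order `ℤ[√d]`, `d ∈ ℤ` (Gaussian integers, `ℤ[√2]`, `ℤ[√-5]`, …;
  `perHard_zsqrtd_log3`); every polynomial ring `ℤ[x_ι]` (`perHard_mvPolynomial_int_log3`).
* §4 THE BOUNDARY (where the method provably says nothing): a ring with `2` a unit has NO map to `𝔽₂`
  (`isEmpty_ringHom_zmod_two_of_isUnit_two`: `ℚ`, `ℤ[½] = Localization.Away 2`, `ℂ`, every field of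
  characteristic `≠ 2`) — the INVERT-2 notch; and `2` may fail to be a unit while every residue field over
  `2` is `⊋ 𝔽₂` (`isEmpty_ringHom_zmod_two_eisenstein`: `ℤ[ω] = ℤ[X]/(X²+X+1)`; `isEmpty_ringHom_galoisField_two_two`:
  `𝔽₄`) — the INERT notch, whose Boolean shadow is `ACC⁰[6]`, beyond every known lower bound.

READING for the decomposition record (lineage 2, WALL-D).  (i) The GRH-free decided region of WALL-D's
constant dial is exactly `{R : Hom(R, 𝔽₂) ≠ ∅}`.  It contains uncountable rings (`ℤ₂`, `ℤ⟦X⟧`), so the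
wall is NOT a description-length / succinctness wall: the lineage's natural-proofs coordinate `β` is
idle here, and the deciding coordinate is arithmetic — an `𝔽₂`-point of the constant ring.  (ii) Over
`ℤ`-skeletons the ℚ-level of the wall is the hardness of ALL non-zero integral multiples `N • per_n`;
this file settles the odd `N` in the kernel.  PAPER (not formalised here, stated for the record): for each
FIXED `N ≠ 0` reduction modulo `2^{v₂(N)+1}` and the folklore simulation `ACC⁰[2^k] = ACC⁰[2]` make
`N • per_n` hard at `Δ₁` as well, so the open core of the ℚ-level is an UNBOUNDED 2-adic valuation of the
multiplier, `v₂(N_n) → ∞` — this corrects the placement "`2^e • per_n`: ACC⁰[2p] frontier" in the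
lineage's g16 node (§2.1, V22).  (iii) Above ℚ: a fixed number field descends to the ℚ-level at the SAME
product depth by local (gate-by-gate) coordinate expansion over a ℚ-basis (paper; polynomial blow-up in
the degree), so the wall proper is the degree of the constant field tending to infinity — `PerEasyAlg`.

All theorems: no `sorry`, no new axioms, no new `def`s (D-0026 debt 0).
-/

namespace Summit.ValiantsHypothesis.ValiantsHypothesis.Theorems.SuccinctLiftResidueTwo
open Literature.Computability.AlgebraicComplexity Literature.Computability.Complexity
  Literature.Computability.MetaComplexity Literature.Computability.MetaComplexity.Smolensky
  Summit.ValiantsHypothesis.ValiantsHypothesis.Theses.SuccinctLift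
  Summit.ValiantsHypothesis.ValiantsHypothesis.Theorems.SuccinctLift
  Summit.ValiantsHypothesis.ValiantsHypothesis.Theorems.SuccinctLiftCharTwo

universe u

/-! ### §1 Per is hard over `𝔽₂` at product-depth `Δ₁` -/

/-- **`¬ D₂` at `Δ₁`**: the permanent has no `(n^c+c)`-wire, product-depth-`Δ₁(n)` circuits over the
prime field `𝔽₂` — the char-2 line of the route with the prime pinned to `2` (Boolean bridge
`boolBridgeF2_proof`, MAJORITY gadget `majorityPermanentMod2_proof`, arithmetic `smolenskyBeatsLog3_proof`,
and the tree's proved `Smolensky.smolensky_majority`). [cite: Razborov1987] -/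
theorem not_perEasyMod_two_log3 :
    ¬ PerEasyMod 2 (fun n => Nat.log 2 (Nat.log 2 (Nat.log 2 n)) + 1) := by
  rintro ⟨c, hc⟩
  obtain ⟨k, hk, ℓ, hℓ, hkℓ⟩ := smolenskyBeatsLog3_proof c
  obtain ⟨m, hm, E, hE⟩ := majorityPermanentMod2_proof k
  obtain ⟨C, hC, hd, hs⟩ := hc m
  obtain ⟨hℓk, hsize⟩ := hkℓ m hm
  set e : Fin (m * m) ≃ Fin m × Fin m := finProdFinEquiv.symm with he
  have hF := boolBridgeF2_proof (m * m) (Fin m × Fin m) e C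
    (Nat.log 2 (Nat.log 2 (Nat.log 2 m)) + 1) (m ^ c + c) hd hs
  have hcomp := hF.comp
    (f := fun j x => Sum.elim (fun b : Bool => b)
      (fun ip : Fin k × Bool => if ip.2 then x ip.1 else !x ip.1) (E (e j)))
    fun j => acRealOver_lit (E (e j))
  have hmajR : ACRealOver (accBasis 2) (majorityFn k)
      (2 * (Nat.log 2 (Nat.log 2 (Nat.log 2 m)) + 1) + 2 + 1)
      ((2 * (m ^ c + c) + 3) ^ (2 * (Nat.log 2 (Nat.log 2 (Nat.log 2 m)) + 1) + 2) + m * m) := by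
    refine (hcomp.congr fun x => ?_).mono le_rfl (by simp)
    simp only [Equiv.apply_symm_apply]
    have hev : MvPolynomial.eval (fun i : Fin m × Fin m =>
        if Sum.elim (fun b : Bool => b) (fun ip : Fin k × Bool => if ip.2 then x ip.1 else !x ip.1) (E i)
        then (1 : ZMod 2) else 0) C.eval = if majorityFn k x then 1 else 0 := by
      rw [hC, eval_perPoly]
      exact hE x
    rw [hev]
    by_cases hmaj : majorityFn k x <;> simp [hmaj]
  obtain ⟨D, hDover, hDdepth, hDsize, hDcomp⟩ := hmajR.toCircuit
  have key := smolensky_majority (p := 2) hk D hDover hDdepth hDcomp hℓ hℓk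
  exact absurd (key.trans (Nat.mul_le_mul_left 8 hDsize)) (not_le.2 hsize)

/-! ### §2 Skeleton-exact transfer along a ring map to a prime field -/

/-- **Transfer along `φ : R →+* S`.**  A circuit over `R` computing `u • per_n` with `φ u = 1` maps
coefficient-wise to a circuit over `S` computing `per_n`, with the same product-depth and the same number
of wires. [cite: Burgisser2000, §4.1] -/
theorem exists_circuit_of_ringHom {R S : Type u} [CommRing R] [CommRing S] (φ : R →+* S)
    {n : ℕ} (u : R) (hu : φ u = 1) (C : ArithCircuit R (Fin n × Fin n))
    (hC : C.Computes (MvPolynomial.C u * perPoly (Fin n) R)) :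
    ∃ D : ArithCircuit S (Fin n × Fin n), D.Computes (perPoly (Fin n) S) ∧
      D.productDepth = C.productDepth ∧ D.edgeSize = C.edgeSize := by
  refine ⟨C.map φ, ?_, ArithCircuit.productDepth_mapCoeff φ C, ArithCircuit.edgeSize_mapCoeff φ C⟩
  show (C.map φ).eval = _
  rw [ArithCircuit.eval_map_apply, hC, map_mul, MvPolynomial.map_C, hu, map_perPoly, MvPolynomial.C_1,
    one_mul]

/-- The case `u = 1`: a circuit for `per_n` over `R` maps to one over `S`, same skeleton.
[cite: Burgisser2000, §4.1] -/
theorem exists_circuit_of_ringHom' {R S : Type u} [CommRing R] [CommRing S] (φ : R →+* S)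
    {n : ℕ} (C : ArithCircuit R (Fin n × Fin n)) (hC : C.Computes (perPoly (Fin n) R)) :
    ∃ D : ArithCircuit S (Fin n × Fin n), D.Computes (perPoly (Fin n) S) ∧
      D.productDepth = C.productDepth ∧ D.edgeSize = C.edgeSize :=
  exists_circuit_of_ringHom φ 1 (map_one φ) C (by rwa [MvPolynomial.C_1, one_mul])

/-- **Hardness over `𝔽_p` transfers to every ring with an `𝔽_p`-point, uniformly, to all unit-class
multiples.**  If per is hard over `ZMod p` at budget `(Δ, n^c+c)`, then for every `c` there is ONE `n`
such that for every commutative ring `R`, every `φ : R →+* ZMod p` and every `u : R` with `φ u = 1`,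
no `R`-circuit within the budget computes `u • per_n`. [cite: Burgisser2000, §4.1] -/
theorem perHard_multiple_of_ringHom {p : ℕ} (Δ : ℕ → ℕ) (h : ¬ PerEasyMod p Δ) (c : ℕ) :
    ∃ n : ℕ, ∀ (R : Type) [CommRing R] (φ : R →+* ZMod p) (u : R), φ u = 1 →
      ¬ ∃ C : ArithCircuit R (Fin n × Fin n), C.Computes (MvPolynomial.C u * perPoly (Fin n) R) ∧
        C.productDepth ≤ Δ n ∧ C.edgeSize ≤ n ^ c + c := by
  by_contra hne
  apply h
  refine ⟨c, fun n => ?_⟩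
  by_contra hn
  apply hne
  refine ⟨n, fun R _ φ u hu hex => ?_⟩
  obtain ⟨C, hCu, hd, hs⟩ := hex
  obtain ⟨D, hD, hdD, hsD⟩ := exists_circuit_of_ringHom φ u hu C hCu
  exact hn ⟨D, hD, hdD ▸ hd, hsD ▸ hs⟩

/-- **Hardness over `𝔽_p` transfers to every ring with an `𝔽_p`-point** (the case `u = 1`).
[cite: Burgisser2000, §4.1] -/
theorem perHard_of_ringHom {p : ℕ} (Δ : ℕ → ℕ) (h : ¬ PerEasyMod p Δ) (c : ℕ) :
    ∃ n : ℕ, ∀ (R : Type) [CommRing R], (R →+* ZMod p) →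
      ¬ ∃ C : ArithCircuit R (Fin n × Fin n), C.Computes (perPoly (Fin n) R) ∧
        C.productDepth ≤ Δ n ∧ C.edgeSize ≤ n ^ c + c := by
  obtain ⟨n, hn⟩ := perHard_multiple_of_ringHom Δ h c
  refine ⟨n, fun R _ φ hex => ?_⟩
  obtain ⟨C, hC, hd, hs⟩ := hex
  exact hn R φ 1 (map_one φ) ⟨C, by rwa [MvPolynomial.C_1, one_mul], hd, hs⟩

/-- Conversely the transfer is monotone DOWN the dial: easiness over `R` with an `𝔽_p`-point gives
easiness over `𝔽_p` (so `¬ D_p` is the STRONGEST statement of its fibre). [cite: Burgisser2000, §4.1] -/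
theorem perEasyMod_of_ringHom {p : ℕ} (Δ : ℕ → ℕ) {R : Type} [CommRing R] (φ : R →+* ZMod p)
    (h : ∃ c : ℕ, ∀ n : ℕ, ∃ C : ArithCircuit R (Fin n × Fin n), C.Computes (perPoly (Fin n) R) ∧
      C.productDepth ≤ Δ n ∧ C.edgeSize ≤ n ^ c + c) : PerEasyMod p Δ := by
  obtain ⟨c, hc⟩ := h
  refine ⟨c, fun n => ?_⟩
  obtain ⟨C, hC, hd, hs⟩ := hc n
  obtain ⟨D, hD, hdD, hsD⟩ := exists_circuit_of_ringHom' φ C hC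
  exact ⟨D, hD, hdD ▸ hd, hsD ▸ hs⟩

/-! ### §3 The rung at `Δ₁`: every constant ring with an `𝔽₂`-point -/

/-- **Master form of the rung.**  For every `c` there is one `n` such that over EVERY commutative ring
`R` with a map `φ : R →+* 𝔽₂`, no `(n^c+c)`-wire product-depth-`Δ₁(n)` circuit computes any multiple
`u • per_n` with `φ u = 1`. [cite: Burgisser2000, §4.1] -/
theorem perHard_multiple_log3_of_ringHom_zmod_two (c : ℕ) :
    ∃ n : ℕ, ∀ (R : Type) [CommRing R] (φ : R →+* ZMod 2) (u : R), φ u = 1 →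
      ¬ ∃ C : ArithCircuit R (Fin n × Fin n), C.Computes (MvPolynomial.C u * perPoly (Fin n) R) ∧
        C.productDepth ≤ Nat.log 2 (Nat.log 2 (Nat.log 2 n)) + 1 ∧ C.edgeSize ≤ n ^ c + c :=
  perHard_multiple_of_ringHom _ not_perEasyMod_two_log3 c

/-- **The rung, plain form**: per is hard at `Δ₁` over every commutative ring with an `𝔽₂`-point.
[cite: Burgisser2000, §4.1] -/
theorem perHard_log3_of_ringHom_zmod_two (c : ℕ) :
    ∃ n : ℕ, ∀ (R : Type) [CommRing R], (R →+* ZMod 2) →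
      ¬ ∃ C : ArithCircuit R (Fin n × Fin n), C.Computes (perPoly (Fin n) R) ∧
        C.productDepth ≤ Nat.log 2 (Nat.log 2 (Nat.log 2 n)) + 1 ∧ C.edgeSize ≤ n ^ c + c :=
  perHard_of_ringHom _ not_perEasyMod_two_log3 c

/-- An odd integer is `1` in `𝔽₂`. [folklore] -/
theorem intCast_zmod_two_of_odd {N : ℤ} (hN : Odd N) : (Int.castRingHom (ZMod 2)) N = 1 := by
  rw [eq_intCast, ← ZMod.intCast_mod N 2]
  rw [Int.odd_iff] at hN
  simp [hN]

/-- **`ℤ`, all odd multiples**: for every `c` some `n` admits no `(n^c+c)`-wire product-depth-`Δ₁(n)`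
circuit with INTEGER constants computing `N • per_n` for any odd `N` (in particular `N = 1`: sign /
integer constants of any height — unconditional, where the route's `HeightLiftAt` needed GRH only for
the ALGEBRAIC step). [cite: KoiranPerifel2011, §2] -/
theorem perHard_int_oddMultiple_log3 (c : ℕ) :
    ∃ n : ℕ, ∀ N : ℤ, Odd N →
      ¬ ∃ C : ArithCircuit ℤ (Fin n × Fin n), C.Computes (MvPolynomial.C N * perPoly (Fin n) ℤ) ∧
        C.productDepth ≤ Nat.log 2 (Nat.log 2 (Nat.log 2 n)) + 1 ∧ C.edgeSize ≤ n ^ c + c := by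
  obtain ⟨n, hn⟩ := perHard_multiple_log3_of_ringHom_zmod_two c
  exact ⟨n, fun N hN => hn ℤ (Int.castRingHom (ZMod 2)) N (intCast_zmod_two_of_odd hN)⟩

/-- **`ℤ`**: per is hard at `Δ₁` over the integers (constants of any height), unconditionally.
[cite: Razborov1987] -/
theorem perHard_int_log3 (c : ℕ) :
    ∃ n : ℕ, ¬ ∃ C : ArithCircuit ℤ (Fin n × Fin n), C.Computes (perPoly (Fin n) ℤ) ∧
      C.productDepth ≤ Nat.log 2 (Nat.log 2 (Nat.log 2 n)) + 1 ∧ C.edgeSize ≤ n ^ c + c := by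
  obtain ⟨n, hn⟩ := perHard_log3_of_ringHom_zmod_two c
  exact ⟨n, hn ℤ (Int.castRingHom (ZMod 2))⟩

/-- **`ℤ/mℤ`, `m` even** (`ℤ/2`, `ℤ/4`, `ℤ/2^k`, `ℤ/6`, …; `m = 0` is `ℤ` again): per is hard at `Δ₁` —
although over `ℤ/2^k` the permanent is computable in polynomial time (Valiant 1979), it has no shallow
polynomial-wire circuits there. [cite: Valiant1979] -/
theorem perHard_zmod_even_log3 {m : ℕ} (hm : 2 ∣ m) (c : ℕ) :
    ∃ n : ℕ, ¬ ∃ C : ArithCircuit (ZMod m) (Fin n × Fin n), C.Computes (perPoly (Fin n) (ZMod m)) ∧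
      C.productDepth ≤ Nat.log 2 (Nat.log 2 (Nat.log 2 n)) + 1 ∧ C.edgeSize ≤ n ^ c + c := by
  obtain ⟨n, hn⟩ := perHard_log3_of_ringHom_zmod_two c
  exact ⟨n, hn (ZMod m) (ZMod.castHom hm (ZMod 2))⟩

/-- **`ℤ/mℤ`, `m` even, unit-class multiples**: no budget circuit over `ℤ/mℤ` computes `u • per_n` for
any `u ≡ 1 (mod 2)` (e.g. `3 • per_n` over `ℤ/4`). [cite: Razborov1987] -/
theorem perHard_zmod_even_multiple_log3 {m : ℕ} (hm : 2 ∣ m) (c : ℕ) :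
    ∃ n : ℕ, ∀ u : ZMod m, ZMod.castHom hm (ZMod 2) u = 1 →
      ¬ ∃ C : ArithCircuit (ZMod m) (Fin n × Fin n),
        C.Computes (MvPolynomial.C u * perPoly (Fin n) (ZMod m)) ∧
        C.productDepth ≤ Nat.log 2 (Nat.log 2 (Nat.log 2 n)) + 1 ∧ C.edgeSize ≤ n ^ c + c := by
  obtain ⟨n, hn⟩ := perHard_multiple_log3_of_ringHom_zmod_two c
  exact ⟨n, fun u hu => hn (ZMod m) (ZMod.castHom hm (ZMod 2)) u hu⟩

/-- **`ℤ₂` (the `2`-adic integers — an uncountable constant ring)**: per is hard at `Δ₁`.  Hence WALL-D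
is not a description-length wall: uncountably many constants are allowed here. [cite: Razborov1987] -/
theorem perHard_padicInt_two_log3 (c : ℕ) :
    ∃ n : ℕ, ¬ ∃ C : ArithCircuit ℤ_[2] (Fin n × Fin n), C.Computes (perPoly (Fin n) ℤ_[2]) ∧
      C.productDepth ≤ Nat.log 2 (Nat.log 2 (Nat.log 2 n)) + 1 ∧ C.edgeSize ≤ n ^ c + c := by
  obtain ⟨n, hn⟩ := perHard_log3_of_ringHom_zmod_two c
  exact ⟨n, hn ℤ_[2] PadicInt.toZMod⟩

/-- **`ℤ₂`, unit multiples congruent to `1`**: e.g. `(1 + 2a) • per_n`, `a ∈ ℤ₂`. [cite: Razborov1987] -/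
theorem perHard_padicInt_two_multiple_log3 (c : ℕ) :
    ∃ n : ℕ, ∀ u : ℤ_[2], PadicInt.toZMod u = 1 →
      ¬ ∃ C : ArithCircuit ℤ_[2] (Fin n × Fin n), C.Computes (MvPolynomial.C u * perPoly (Fin n) ℤ_[2]) ∧
        C.productDepth ≤ Nat.log 2 (Nat.log 2 (Nat.log 2 n)) + 1 ∧ C.edgeSize ≤ n ^ c + c := by
  obtain ⟨n, hn⟩ := perHard_multiple_log3_of_ringHom_zmod_two c
  exact ⟨n, fun u hu => hn ℤ_[2] PadicInt.toZMod u hu⟩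

/-- **Every quadratic order `ℤ[√d]`, `d ∈ ℤ`** (Gaussian integers `d = -1`, `ℤ[√2]`, `ℤ[√-5]`, …): per is
hard at `Δ₁` with constants from `ℤ[√d]`. [cite: Razborov1987] -/
theorem perHard_zsqrtd_log3 (d : ℤ) (c : ℕ) :
    ∃ n : ℕ, ¬ ∃ C : ArithCircuit (ℤ√d) (Fin n × Fin n), C.Computes (perPoly (Fin n) (ℤ√d)) ∧
      C.productDepth ≤ Nat.log 2 (Nat.log 2 (Nat.log 2 n)) + 1 ∧ C.edgeSize ≤ n ^ c + c := by
  obtain ⟨n, hn⟩ := perHard_log3_of_ringHom_zmod_two c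
  -- in `𝔽₂` every element is idempotent, so `√d ↦ d mod 2` defines `ℤ[√d] →+* 𝔽₂` for EVERY `d`
  exact ⟨n, hn (ℤ√d) (Zsqrtd.lift ⟨(d : ZMod 2),
    Literature.LinearAlgebra.QuadraticForm.zmod_two_mul_self _⟩)⟩

/-- **`ℤ⟦X⟧` (an uncountable constant ring)**: per is hard at `Δ₁`. [cite: Razborov1987] -/
theorem perHard_powerSeries_int_log3 (c : ℕ) :
    ∃ n : ℕ, ¬ ∃ C : ArithCircuit (PowerSeries ℤ) (Fin n × Fin n),
      C.Computes (perPoly (Fin n) (PowerSeries ℤ)) ∧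
      C.productDepth ≤ Nat.log 2 (Nat.log 2 (Nat.log 2 n)) + 1 ∧ C.edgeSize ≤ n ^ c + c := by
  obtain ⟨n, hn⟩ := perHard_log3_of_ringHom_zmod_two c
  exact ⟨n, hn (PowerSeries ℤ) ((Int.castRingHom (ZMod 2)).comp PowerSeries.constantCoeff)⟩

/-- **Every polynomial ring `ℤ[x_ι]`** (any index type): per is hard at `Δ₁` with polynomial
"constants". [cite: Razborov1987] -/
theorem perHard_mvPolynomial_int_log3 (ι : Type) (c : ℕ) :
    ∃ n : ℕ, ¬ ∃ C : ArithCircuit (MvPolynomial ι ℤ) (Fin n × Fin n),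
      C.Computes (perPoly (Fin n) (MvPolynomial ι ℤ)) ∧
      C.productDepth ≤ Nat.log 2 (Nat.log 2 (Nat.log 2 n)) + 1 ∧ C.edgeSize ≤ n ^ c + c := by
  obtain ⟨n, hn⟩ := perHard_log3_of_ringHom_zmod_two c
  exact ⟨n, hn (MvPolynomial ι ℤ) (MvPolynomial.eval₂Hom (Int.castRingHom (ZMod 2)) fun _ => 0)⟩

/-- **Dial order**: the `𝔽₂`-level is the bottom of its fibre — easiness over any ring with an
`𝔽₂`-point (e.g. over `ℤ`, `ℤ₂`, `ℤ[i]`) would give easiness over `𝔽₂`. [cite: Burgisser2000, §4.1] -/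
theorem perEasyMod_two_of_int (Δ : ℕ → ℕ)
    (h : ∃ c : ℕ, ∀ n : ℕ, ∃ C : ArithCircuit ℤ (Fin n × Fin n), C.Computes (perPoly (Fin n) ℤ) ∧
      C.productDepth ≤ Δ n ∧ C.edgeSize ≤ n ^ c + c) : PerEasyMod 2 Δ :=
  perEasyMod_of_ringHom Δ (Int.castRingHom (ZMod 2)) h

/-! ### §4 The boundary of the method: rings without an `𝔽₂`-point -/

/-- **INVERT-2 notch.**  If `2` is a unit of `R` there is no ring map `R → 𝔽₂`; the transfer of §2–§3 is
void for such constants (`ℚ`, `ℤ[½]`, `ℝ`, `ℂ`, `ℚ̄`, every field of characteristic `≠ 2`). [folklore] -/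
theorem isEmpty_ringHom_zmod_two_of_isUnit_two {R : Type u} [CommRing R] (h : IsUnit (2 : R)) :
    IsEmpty (R →+* ZMod 2) := by
  refine ⟨fun φ => ?_⟩
  have h2 := h.map φ
  rw [map_ofNat, show (2 : ZMod 2) = 0 from rfl] at h2
  exact zero_ne_one (isUnit_zero_iff.mp h2)

/-- `ℚ` has no `𝔽₂`-point. [folklore] -/
theorem isEmpty_ringHom_rat_zmod_two : IsEmpty (ℚ →+* ZMod 2) :=
  isEmpty_ringHom_zmod_two_of_isUnit_two (isUnit_iff_ne_zero.mpr two_ne_zero)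

/-- `ℂ` has no `𝔽₂`-point. [folklore] -/
theorem isEmpty_ringHom_complex_zmod_two : IsEmpty (ℂ →+* ZMod 2) :=
  isEmpty_ringHom_zmod_two_of_isUnit_two (isUnit_iff_ne_zero.mpr two_ne_zero)

/-- `ℤ[½] = Localization.Away (2 : ℤ)` has no `𝔽₂`-point: the first notch of the dial above the rung.
[folklore] -/
theorem isEmpty_ringHom_awayTwo_zmod_two : IsEmpty (Localization.Away (2 : ℤ) →+* ZMod 2) := by
  refine isEmpty_ringHom_zmod_two_of_isUnit_two ?_
  have h := IsLocalization.Away.algebraMap_isUnit (S := Localization.Away (2 : ℤ)) (2 : ℤ)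
  rwa [map_ofNat] at h

/-- Every field of characteristic `≠ 2` (more generally every ring in which `2 ≠ 0` is invertible) has
no `𝔽₂`-point. [folklore] -/
theorem isEmpty_ringHom_field_zmod_two {F : Type u} [Field F] (h2 : (2 : F) ≠ 0) :
    IsEmpty (F →+* ZMod 2) :=
  isEmpty_ringHom_zmod_two_of_isUnit_two (isUnit_iff_ne_zero.mpr h2)

/-- No element of `𝔽₂` is a primitive cube root of unity. [folklore] -/
theorem zmod_two_sq_add_self_add_one_ne_zero (r : ZMod 2) : r ^ 2 + r + 1 ≠ 0 := by
  revert r; decide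

/-- **INERT notch, ring side.**  The Eisenstein order `ℤ[ω] = ℤ[X]/(X² + X + 1)` — in which `2` is NOT
a unit — has no `𝔽₂`-point either (its residue field over `2` is `𝔽₄`): constants from `ℤ[ω]` are
outside the rung although no prime is inverted. [folklore] -/
theorem isEmpty_ringHom_zmod_two_eisenstein :
    IsEmpty (AdjoinRoot (Polynomial.X ^ 2 + Polynomial.X + 1 : Polynomial ℤ) →+* ZMod 2) := by
  refine ⟨fun φ => ?_⟩
  have h0 := congrArg φ (AdjoinRoot.eval₂_root (Polynomial.X ^ 2 + Polynomial.X + 1 : Polynomial ℤ))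
  simp only [Polynomial.eval₂_add, Polynomial.eval₂_X_pow, Polynomial.eval₂_X, Polynomial.eval₂_one,
    map_add, map_pow, map_one, map_zero] at h0
  exact zmod_two_sq_add_self_add_one_ne_zero _ h0

/-- **INERT notch, field side.**  `𝔽₄` has no `𝔽₂`-point (ring maps out of a field are injective).
[folklore] -/
theorem isEmpty_ringHom_galoisField_two_two : IsEmpty (GaloisField 2 2 →+* ZMod 2) := by
  refine ⟨fun φ => ?_⟩
  have hle := Nat.card_le_card_of_injective φ φ.injective
  rw [GaloisField.card 2 2 two_ne_zero, Nat.card_eq_fintype_card, ZMod.card] at hle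
  omega

end Summit.ValiantsHypothesis.ValiantsHypothesis.Theorems.SuccinctLiftResidueTwo
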